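import Mathlib.MeasureTheory.Integral.Bochner.Basic
import Literature.Geometry.Lorentzian.TrappedSurface
import Literature.Geometry.Lorentzian.Volume
import Literature.Geometry.Lorentzian.NullInfinity
import Literature.Geometry.Lorentzian.AsymptoticFlatness
import HarnessLib

-- provenance: harness21/H21/H21/Prelude/Lorentz/BondiMass.lean @ bdb687b (interim HEAD d8f2665); M5 mechanical rewrite
-- dependency-drift fix (`hpb`, `[HasLeviCivita]`; librarian-librarian-g8-0, 2026-08-13)
/-!
# Hawking mass and Bondi mass (trunk G08 = T-LORENTZ, item C25, tier L)

The **Hawking mass** of a closed spacelike `2`-surface `f : S → M` in a time-oriented Lorentzian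
`4`-manifold `(M, g, τ)` with null normal pair `(L, L̲)`, `g(L, L̲) = -2`,

  `m_H(S) = √(|S| / 16π) · (1 + (16π)⁻¹ ∫_S θ_L θ_L̲ dA)`,

where `|S|` is the area and `θ_L`, `θ_L̲` are the null expansions (Hawking 1968; Christodoulou–
Klainerman 1993, Ch. 17); and the **Bondi mass** of a spacetime developing from Cauchy data,
rendered *intrinsically* (without a conformal boundary and without the news tensor) through the
*hypothesis structure* `BondiFoliation 𝒟`: a family of outgoing null cones `C⁺_u = ∂J⁺(ι B_u)`
labelled by a retarded time `u`, each foliated by closed spacelike `2`-surfaces `S_{u,s}` receding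
to infinity as `s → ∞`, with the Bondi mass `M_B(u) := lim_{s → ∞} m_H(S_{u,s})` (Christodoulou–
Klainerman 1993, Ch. 17, conclusions 17.0.1–17.0.9: the Hawking masses of the sections of the
outgoing cones converge to the Bondi mass; Bondi–van der Burg–Metzner 1962). Statement **gr.S25**
is bold-tagged on `BondiFoliation.bondiMass`.

## Main definitions (`namespace Literature.Lorentz`)

* `LorentzianMetric.hawkingMass g f hf P : ℝ` — the Hawking mass (area and integral w.r.t. the
  Euclidean-normalised `2`-dimensional Riemannian volume `riemannianVolume (f^* g) 2` of
  `Volume.lean`).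
* `BondiFoliation 𝒟` — hypothesis structure (surface type with its instances as fields, compact
  pieces `B u ⊆ X` of the data, sections `sec u s : surf → M` of the cones `∂J⁺(ι (B u))`, their
  null normal pairs with `L` tangent to the cone generators, sections receding to infinity).
* `BondiFoliation.bondiMass 𝓕 u` (**gr.S25**), `BondiFoliation.HasBondiMass`,
  `BondiFoliation.finalBondiMass`, `BondiFoliation.HasFinalBondiMass`.
* `BondiFoliation.IsCanonical 𝓕 e` — hypothesis structure recording what the cited works prove
  for *their* (optical-function) foliations: convergence of the Hawking masses, Bondi mass loss,
  positivity, and the bound by the ADM energy of the end `e`.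
* Consequences (all proved, no `sorry` in this file): `BondiFoliation.bondiMass_antitone` (Bondi
  mass loss), `BondiFoliation.bondiMass_nonneg`, `BondiFoliation.bondiMass_le_admEnergy`,
  `BondiFoliation.IsCanonical.hasFinalBondiMass`, `BondiFoliation.finalBondiMass_le_admEnergy`,
  `BondiFoliation.finalBondiMass_nonneg`.
  (The outline, Lorentz.md, lists `bondiMass_antitone`/`finalBondiMass_le_admEnergy` as sorried
  theorems; as bare statements about an arbitrary `BondiFoliation` they are *false* — see
  `IsCanonical` — so they take `IsCanonical` as a hypothesis instead; the architect should amend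
  the outline.)

## Mathlib

Mathlib (at the pin) has no Hawking or Bondi mass (`rg -i 'hawking|bondi' Mathlib` is empty), no
Lorentzian geometry and no Riemannian volume. We use the Bochner integral
(`Mathlib.MeasureTheory.Integral.Bochner.Basic`), `Real.sqrt`, `Real.pi`, `Filter.limUnder`,
`Filter.Tendsto`, `Antitone`, `tendsto_atTop_ciInf`; everything geometric comes from the H21
modules `TrappedSurface` (`NullNormalPair`, `nullExpansion`), `Hypersurface` (`IsSpacelikeImmersion`,
`inducedRiemannianMetric`), `Volume` (`riemannianVolume`, `totalArea`), `NullInfinity`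
(`futureNullConeBoundary`), `Geodesic` (`IsGeodesicOn`, `velocity`), `Development`,
`AsymptoticFlatness` (`AFEnd`, `AFEnd.admEnergy`), `Einstein` (`IsRicciFlat`).

## Design choices

* *Normalisation and signs.* With `g(L, L̲) = -2` (the normalisation of `NullNormalPair`) and the
  sign convention (h) `χ_L(v, w) = + g(D_v L, df w)`, a round sphere of radius `r` in Minkowski
  space has `θ_L = 2/r`, `θ_L̲ = -2/r`, so `∫ θ_L θ_L̲ dA = -16π` and `m_H = 0`; in time-symmetric
  data `θ_L θ_L̲ = -H²` and `m_H = √(|S|/16π)(1 - (16π)⁻¹ ∫ H²)` (Geroch, Huisken–Ilmanen). The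
  formula is symmetric under the swap `L ↔ L̲` (`hawkingMass_swap`) and invariant under the boost
  rescalings `(L, L̲) ↦ (a L, a⁻¹ L̲)`.
* *Measure.* Area and integral use `riemannianVolume (f^* g) 2`, the `μHE[2]`-normalised Hausdorff
  measure of the induced length metric (`Volume.lean`, review F1/F1b); hence the surface type
  carries `[MeasurableSpace S] [BorelSpace S]` hypotheses, and `BondiFoliation.surf` carries them
  as instance fields. The Bochner integral returns the junk value `0` for a non-integrable
  integrand (never the case for `C¹` null normals on a compact surface, where `θ_L θ_L̲` is
  continuous and the measure is finite, `riemannianVolume_lt_top_of_isCompact`).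
* *Dimension.* The constants `16π` and the area exponent `2` are those of `2`-surfaces in
  `3 + 1` dimensions; accordingly `BondiFoliation` is defined for developments of
  `3`-dimensional data (`D : InitialDataSet (𝓡 3) X`), while `hawkingMass` itself is stated for an
  arbitrary surface model `I''` (it is only *meant* for `dim S = 2`, `dim M = 4`).
* *Retarded time and monotonicity of `B`.* In Minkowski space `∂J⁺(B̄_R) = {t - r = -R}`: larger
  compact pieces of the data give *earlier* outgoing cones. We therefore ask `u ↦ B u` to be
  **antitone** and to exhaust `X` as `u → -∞`; then `u` increases towards the future, the Bondi
  mass-loss law reads `Antitone (bondiMass 𝓕)`, and the final Bondi mass is `lim_{u → +∞}`.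
* *What the hypothesis structure does and does not encode.* `BondiFoliation` records: the
  sections lie on the cone `∂J⁺(ι (B u))`, are compact spacelike embedded surfaces, carry a null
  normal pair whose outgoing leg `L` is tangent to the null geodesic generators of the cone, and
  recede to infinity (`area → ∞` as `s → ∞`). It does **not** encode the asymptotic roundness of
  the sections needed to identify `lim m_H` with the Bondi mass of a specific cut of `𝓘⁺`, nor the
  news tensor `Ξ` and the exact mass-loss formula `∂_u M_B = -(32π)⁻¹ ∫ |Ξ|²` (Christodoulou–
  Klainerman 1993, 17.0.8), which are **out of scope** (tier L, notion `bondi_mass_news`).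
  Consequently the limit `lim_s m_H(S_{u,s})` is *under-determined* by `BondiFoliation`: already
  on a shear-free Schwarzschild cone, sections `r = s R(ω)` give `lim m_H = M √(⨍R²) ⨍(1/R) ≥ M`
  with equality iff `R` is constant. The printed results (mass loss, positivity, `M_B ≤ E_ADM`)
  hold for the canonical foliations of the cited works and are recorded as the hypothesis
  structure `IsCanonical` (CONVENTIONS: hypothesis structure rather than a refutable sorried
  theorem); no field of `BondiFoliation` relates `sec u s` for different `s` either (only a
  *family* of sections is needed to take limits; no leaf/disjointness property is imposed).
  `bondiMass`/`finalBondiMass` are `limUnder`s (junk if the limit does not exist — the honest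
  predicates are `HasBondiMass`, `HasFinalBondiMass`).
* *M5 migration (dependency drift).* As prescribed by `Hypersurface.lean`/`TrappedSurface.lean`,
  everything built on the induced metric carries the smoothness hypothesis
  `hpb : contMDiff_pullbackBilin I M I'' S n` (a named fact of `Isometry.lean`) threaded next to
  `hf`, and everything built on `nullExpansion` the standing Levi-Civita hypothesis
  `[g.HasLeviCivita]`. In the hypothesis structure `BondiFoliation` both are fields (`hpb`,
  `[hasLeviCivita]`, exactly as in `OutermostMOTS`), so `bondiMass 𝓕 u` keeps its signature.

## References

* S. W. Hawking, *Gravitational radiation in an expanding universe*, J. Math. Phys. 9 (1968)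
  598–604 (the Hawking mass).
* H. Bondi, M. G. J. van der Burg, A. W. K. Metzner, *Gravitational waves in general relativity
  VII*, Proc. Roy. Soc. A 269 (1962) 21–52 (Bondi mass, news, mass loss).
* R. K. Sachs, Proc. Roy. Soc. A 270 (1962) 103–126.
* D. Christodoulou, S. Klainerman, *The global nonlinear stability of the Minkowski space*,
  Princeton 1993, Ch. 17, conclusions 17.0.1–17.0.9 (Hawking mass → Bondi mass along the cones,
  Bondi mass-loss formula, final Bondi mass, relation with the ADM mass).
* R. Schoen, S.-T. Yau, *Proof that the Bondi mass is positive*, Phys. Rev. Lett. 48 (1982) 369;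
  G. T. Horowitz, M. J. Perry, Phys. Rev. Lett. 48 (1982) 371; M. Ludvigsen, J. A. G. Vickers,
  J. Phys. A 15 (1982) L67 (positivity of the Bondi mass).
* R. M. Wald, *General Relativity*, Chicago 1984, §11.2 (Bondi energy, (11.2.13) ff.).
-/

noncomputable section

open Bundle Set Manifold TopologicalSpace Filter MeasureTheory Real
open scoped ContDiff Topology ENNReal

namespace Literature.Geometry.Lorentzian

/-! ### The Hawking mass -/

namespace LorentzianMetric

variable {E : Type*} [NormedAddCommGroup E] [NormedSpace ℝ E] {H : Type*} [TopologicalSpace H]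
  {I : ModelWithCorners ℝ E H} {M : Type*} [TopologicalSpace M] [ChartedSpace H M]
  {E'' : Type*} [NormedAddCommGroup E''] [NormedSpace ℝ E''] {H'' : Type*} [TopologicalSpace H'']
  {I'' : ModelWithCorners ℝ E'' H''} {S : Type*} [TopologicalSpace S] [ChartedSpace H'' S]
  [IsManifold I ∞ M] {n : ℕ∞ω}
  [FiniteDimensional ℝ E] [CompleteSpace E] [Fact (1 ≤ n)] [FiniteDimensional ℝ E'']
  [IsManifold I'' ∞ S] [CompactSpace S] [T2Space S] [MeasurableSpace S] [BorelSpace S]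
  (g : LorentzianMetric I n M) [g.HasLeviCivita] {τ : TimeOrientation g} (f : S → M)

/-- The **Hawking mass** of the compact spacelike immersed surface `f : S → M` of the
time-oriented Lorentzian manifold `(M, g, τ)` with respect to the null normal pair `P = (L, L̲)`
(normalised by `g(L, L̲) = -2`):
`m_H = √(|S| / 16π) · (1 + (16π)⁻¹ ∫_S θ_L θ_L̲ dA)`, where `|S| = totalArea (f^* g)` is the area
and `dA = riemannianVolume (f^* g) 2` the area measure of the induced Riemannian metric
(Euclidean-normalised `2`-dimensional Hausdorff measure of the induced length metric), and
`θ_L`, `θ_L̲` are the null expansions (`nullExpansion`, sign convention (h)). Junk values: `toReal`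
of the area (the area is finite for compact `S`, `riemannianVolume_lt_top_of_isCompact`, so none
arises) and the Bochner integral of a non-integrable integrand (`0`). For a round sphere in
Minkowski space `θ_L θ_L̲ = -4/r²` and `m_H = 0`; for a round sphere of area radius `r` in
Schwarzschild `m_H = M`. Meant for `dim S = 2`, `dim M = 4`. Hypotheses `hpb` (smoothness of
pullbacks, as for `inducedRiemannianMetric`) and `[g.HasLeviCivita]` (as for `nullExpansion`). Hawking, J. Math. Phys. 9 (1968)
598, eq. (3.7); Christodoulou–Klainerman 1993, Ch. 17 (p. 495 ff.); Wald 1984, Problem 11.3. [cite: ChristodoulouKlainerman1993, Ch. 17 (p. 495 ff] -/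
def hawkingMass (hpb : PseudoRiemannianMetric.contMDiff_pullbackBilin I M I'' S n)
    (hf : g.IsSpacelikeImmersion I'' f) (P : NullNormalPair I'' g τ f) : ℝ :=
  √((totalArea (g.inducedRiemannianMetric f hpb hf)).toReal / (16 * π)) *
    (1 + (16 * π)⁻¹ *
      ∫ y, g.nullExpansion f hpb hf P.L y * g.nullExpansion f hpb hf P.Lbar y
        ∂(riemannianVolume (g.inducedRiemannianMetric f hpb hf) 2))

omit [CompleteSpace E] [Fact (1 ≤ n)] in
/-- The Hawking mass is symmetric under the swap `(L, L̲) ↦ (L̲, L)` of the null normal pair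
(the integrand `θ_L θ_L̲` is symmetric). Hawking 1968, (3.7). [cite: Hawking1968, (3.7] -/
lemma hawkingMass_swap (hpb : PseudoRiemannianMetric.contMDiff_pullbackBilin I M I'' S n)
    (hf : g.IsSpacelikeImmersion I'' f) (P : NullNormalPair I'' g τ f) :
    g.hawkingMass f hpb hf P.swap = g.hawkingMass f hpb hf P := by
  simp only [hawkingMass, NullNormalPair.swap, mul_comm (g.nullExpansion f hpb hf P.Lbar _)]

omit [CompleteSpace E] [Fact (1 ≤ n)] in
/-- The Hawking mass in terms of the area `|S|` and the integral `∫ θ_L θ_L̲`: if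
`∫_S θ_L θ_L̲ dA = -16π` (e.g. round spheres in Minkowski space, or, by Gauss–Bonnet, every cut of
a shear-free vacuum flat cone), the Hawking mass vanishes. Hawking 1968, §3. [cite: Hawking1968, §3] -/
lemma hawkingMass_eq_zero_of_integral_eq
    (hpb : PseudoRiemannianMetric.contMDiff_pullbackBilin I M I'' S n)
    (hf : g.IsSpacelikeImmersion I'' f) (P : NullNormalPair I'' g τ f)
    (h : ∫ y, g.nullExpansion f hpb hf P.L y * g.nullExpansion f hpb hf P.Lbar y
        ∂(riemannianVolume (g.inducedRiemannianMetric f hpb hf) 2) = -(16 * π)) :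
    g.hawkingMass f hpb hf P = 0 := by
  have hπ : (16 * π) ≠ 0 := by positivity
  rw [hawkingMass, h, mul_neg, inv_mul_cancel₀ hπ, add_neg_cancel, mul_zero]

end LorentzianMetric

/-! ### Bondi foliations (hypothesis structure) and the Bondi mass -/

universe u

variable {X : Type u} [TopologicalSpace X] [ChartedSpace E3 X] [IsManifold (𝓡 3) ∞ X]
  [ConnectedSpace X] {D : InitialDataSet (𝓡 3) X}

/-- Hypothesis structure: a **Bondi foliation** of the development `𝒟 = (M, g, τ, ι, ν)` of the
`3`-dimensional initial data set `D` — the intrinsic data from which the Bondi mass is defined as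
a limit of Hawking masses along outgoing null cones (Christodoulou–Klainerman 1993, Ch. 17;
Christodoulou, CQG 16 (1999) A23, p. A26). It bundles

* a surface type `surf` (a compact Hausdorff smooth `2`-manifold modelled on
  `EuclideanSpace ℝ (Fin 2)`, with its Borel measurable structure; the seven instances are fields,
  made instances below), the smoothness fact `hpb` for pullbacks of metrics to `surf` and the
  standing Levi-Civita hypothesis `[hasLeviCivita : g.HasLeviCivita]` (M5 migration, as in
  `OutermostMOTS`);
* an **antitone** family `u ↦ B u` of compact pieces of the data manifold `X`, exhausting `X` as
  `u → -∞` (`u` is a *retarded time*: larger `B` gives an earlier outgoing cone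
  `C⁺_u := ∂J⁺(ι (B u))`, cf. the module docstring);
* for each `u` a one-parameter family `s ↦ sec u s : surf → M` of compact smoothly embedded
  spacelike sections of the cone `C⁺_u`, receding to infinity along the cone (their areas tend to
  `∞` as `s → ∞`); despite the name, **no foliation property** (disjointness of the sections for
  different `s`, covering of the cone) is imposed — the limits below only need a family;
* for each section a null normal pair `pair u s = (L, L̲)` (`g(L, L̲) = -2`) whose outgoing leg `L`
  is **tangent to the null geodesic generators** of `C⁺_u`: the geodesic with initial data
  `(sec u s y, L y)` runs inside `C⁺_u` for small positive affine parameter.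

The news tensor and the asymptotic roundness of the sections are not encoded (tier L, notion
`bondi_mass_news`; see the module docstring and `BondiFoliation.IsCanonical`). [cite: ChristodoulouKlainerman1993, Ch. 17] -/
structure BondiFoliation (𝒟 : Development D) where
  /-- The surface type of the sections. -/
  surf : Type
  /-- Topology of the surface type. -/
  [top : TopologicalSpace surf]
  /-- The surface type is a `2`-manifold. -/
  [charted : ChartedSpace (EuclideanSpace ℝ (Fin 2)) surf]
  /-- The surface type is a smooth manifold. -/
  [mfd : IsManifold (𝓡 2) ∞ surf]
  /-- The surface type is compact. -/
  [compact : CompactSpace surf]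
  /-- The surface type is Hausdorff. -/
  [t2 : T2Space surf]
  /-- Measurable structure of the surface type (for areas and integrals). -/
  [meas : MeasurableSpace surf]
  /-- The measurable structure is the Borel one. -/
  [borel : BorelSpace surf]
  /-- Standing hypothesis: `g` has its Levi-Civita connection (M5 migration). -/
  [hasLeviCivita : 𝒟.metric.toPseudoRiemannianMetric.HasLeviCivita]
  /-- The smoothness fact for pullbacks of metrics along maps `surf → M` (M5 migration). -/
  hpb : PseudoRiemannianMetric.contMDiff_pullbackBilin (𝓡 (3 + 1)) 𝒟.carrier (𝓡 2) surf ∞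
  /-- The compact pieces `B u ⊆ X` of the data, labelled by retarded time `u`. -/
  B : ℝ → Set X
  /-- Each `B u` is compact. -/
  isCompact_B (u : ℝ) : IsCompact (B u)
  /-- Later retarded times correspond to smaller pieces of the data. -/
  antitone_B : Antitone B
  /-- The pieces exhaust the data manifold (as `u → -∞`). -/
  iUnion_B : ⋃ u, B u = univ
  /-- The sections `S_{u,s} = sec u s : surf → M` of the outgoing cones. -/
  sec : ℝ → ℝ → surf → 𝒟.carrier
  /-- The section `S_{u,s}` lies on the outgoing cone `C⁺_u = ∂J⁺(ι (B u))`. -/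
  range_sec_subset (u s : ℝ) :
    range (sec u s) ⊆ 𝒟.metric.futureNullConeBoundary 𝒟.timeOrientation 𝒟.embed (B u)
  /-- Each section is a smooth embedding. -/
  isSmoothEmbedding (u s : ℝ) : Manifold.IsSmoothEmbedding (𝓡 2) (𝓡 (3 + 1)) ∞ (sec u s)
  /-- Each section is a spacelike immersion. -/
  isSpacelike (u s : ℝ) : 𝒟.metric.IsSpacelikeImmersion (𝓡 2) (sec u s)
  /-- The null normal pair `(L, L̲)` of each section, `L` outgoing. -/
  pair (u s : ℝ) : LorentzianMetric.NullNormalPair (𝓡 2) 𝒟.metric 𝒟.timeOrientation (sec u s)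
  /-- `L` is tangent to the null geodesic generators of the cone `C⁺_u`: the geodesic through
  `sec u s y` with velocity `L y` lies in `C⁺_u` for small positive affine parameter. -/
  tangent_L (u s : ℝ) (y : surf) :
    ∃ (γ : ℝ → 𝒟.carrier) (ε : ℝ), 0 < ε ∧
      IsGeodesicOn 𝒟.metric.leviCivita γ (Ioo (-ε) ε) ∧ γ 0 = sec u s y ∧
      velocity (𝓡 (3 + 1)) γ 0 = (pair u s).L y ∧
      ∀ t ∈ Ioo 0 ε, γ t ∈ 𝒟.metric.futureNullConeBoundary 𝒟.timeOrientation 𝒟.embed (B u)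
  /-- The sections recede to infinity along each cone: their areas tend to `∞` as `s → ∞`. -/
  tendsto_area (u : ℝ) :
    Tendsto
      (fun s ↦ totalArea (𝒟.metric.inducedRiemannianMetric (sec u s) hpb (isSpacelike u s)))
      atTop (𝓝 ⊤)

namespace BondiFoliation

attribute [instance] top charted mfd compact t2 meas borel

variable {𝒟 : Development D} (𝓕 : BondiFoliation 𝒟)

/-- The Hawking mass `m_H(S_{u,s})` of the section `S_{u,s}` of a Bondi foliation (with respect
to its null normal pair, the bundled smoothness fact `hpb` and Levi-Civita hypothesis).
Christodoulou–Klainerman 1993, Ch. 17. [cite: ChristodoulouKlainerman1993, Ch. 17] -/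
def sectionHawkingMass (u s : ℝ) : ℝ :=
  haveI := 𝓕.hasLeviCivita
  𝒟.metric.hawkingMass (𝓕.sec u s) 𝓕.hpb (𝓕.isSpacelike u s) (𝓕.pair u s)

/-- The Bondi foliation **has Bondi mass `m` at retarded time `u`**: the Hawking masses of the
sections `S_{u,s}` of the outgoing cone `C⁺_u` converge to `m` as `s → ∞`. Christodoulou–
Klainerman 1993, Ch. 17, conclusion 17.0.3 (the Hawking mass tends to the Bondi mass along
`C⁺_u`); Hawking 1968, §3. [cite: Klainerman1993, Ch. 17  conclusion 17.0.3 (the Hawking m] -/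
def HasBondiMass (u m : ℝ) : Prop :=
  Tendsto (𝓕.sectionHawkingMass u) atTop (𝓝 m)

/-- **gr.S25** (Bondi mass along `𝓘⁺`; Bondi–van der Burg–Metzner, Proc. Roy. Soc. A 269
(1962); Christodoulou–Klainerman 1993, Ch. 17, conclusions 17.0.1–17.0.9). The **Bondi mass**
`M_B(u) = lim_{s → ∞} m_H(S_{u,s})` of the Bondi foliation at retarded time `u`: the limit of the
Hawking masses of the sections of the outgoing null cone `C⁺_u = ∂J⁺(ι (B u))` as they recede to
null infinity (Mathlib's `limUnder`; a **junk value** if the limit does not exist — the honest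
predicate is `HasBondiMass`). The news function and the exact mass-loss formula
`∂_u M_B = -(32π)⁻¹ ∫_{S²} |Ξ|²` are out of scope; the properties of the canonical foliations
of the cited works are the hypothesis structure `IsCanonical`, mass loss is `bondiMass_antitone`,
and the final Bondi mass vs the ADM mass is `finalBondiMass_le_admEnergy`. [cite: ChristodoulouKlainerman1993, Ch. 17  conclusions 17.0.1–17.0.9] -/
def bondiMass (u : ℝ) : ℝ :=
  limUnder atTop (𝓕.sectionHawkingMass u)

/-- The Bondi foliation **has final Bondi mass `m`**: `M_B(u) → m` as `u → +∞`.
Christodoulou–Klainerman 1993, Ch. 17, conclusion 17.0.9. [cite: ChristodoulouKlainerman1993, Ch. 17  conclusion 17.0.9] -/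
def HasFinalBondiMass (m : ℝ) : Prop :=
  Tendsto 𝓕.bondiMass atTop (𝓝 m)

/-- The **final Bondi mass** `M_B(+∞) = lim_{u → +∞} M_B(u)` (`limUnder`; junk value if the
limit does not exist, see `HasFinalBondiMass`). In the final-state picture
`E_ADM - M_B(+∞)` is the total energy radiated through `𝓘⁺`. Christodoulou–Klainerman 1993,
Ch. 17, conclusion 17.0.9; Wald 1984, §11.2. [cite: ChristodoulouKlainerman1993, Ch. 17  conclusion 17.0.9] -/
def finalBondiMass : ℝ :=
  limUnder atTop 𝓕.bondiMass

variable {𝓕}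

/-- If the Hawking masses along `C⁺_u` converge to `m`, the Bondi mass at `u` is `m`. [folklore] -/
lemma HasBondiMass.bondiMass_eq {u m : ℝ} (h : 𝓕.HasBondiMass u m) : 𝓕.bondiMass u = m :=
  h.limUnder_eq

/-- If the Bondi masses converge to `m` as `u → +∞`, the final Bondi mass is `m`. [folklore] -/
lemma HasFinalBondiMass.finalBondiMass_eq {m : ℝ} (h : 𝓕.HasFinalBondiMass m) :
    𝓕.finalBondiMass = m :=
  h.limUnder_eq

/-- If the Bondi mass exists at every retarded time, `HasBondiMass u (bondiMass u)`. [folklore] -/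
lemma hasBondiMass_bondiMass (h : ∀ u, ∃ m, 𝓕.HasBondiMass u m) (u : ℝ) :
    𝓕.HasBondiMass u (𝓕.bondiMass u) := by
  obtain ⟨m, hm⟩ := h u
  rwa [hm.bondiMass_eq]

variable (𝓕)

/-- Hypothesis structure: `𝓕` is a **canonical Bondi foliation** of the development `𝒟` for the
asymptotically flat end `e` of the data. It records, as hypotheses, the properties which
Christodoulou–Klainerman 1993, Ch. 17 (conclusions 17.0.3, 17.0.8, 17.0.9) and Schoen–Yau,
Phys. Rev. Lett. 48 (1982) 369, establish for the *optical-function foliation* of a vacuum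
development of strongly asymptotically flat data (sections asymptotic to the round cuts of the
data's own asymptotic rest frame):

* the Hawking masses converge along every outgoing cone (`hasBondiMass`, CK 17.0.3);
* **Bondi mass loss** `∂_u M_B = -(32π)⁻¹ ∫ |Ξ|² ≤ 0` (`bondiMass_antitone`; Bondi–van der Burg–
  Metzner, Proc. Roy. Soc. A 269 (1962), §5; CK 17.0.8);
* **positivity of the Bondi mass** (`bondiMass_nonneg`; Schoen–Yau 1982, Horowitz–Perry 1982,
  Ludvigsen–Vickers 1982);
* `M_B(u) ≤ E_ADM` (`bondiMass_le_admEnergy`; CK 17.0.8–17.0.9, Ashtekar–Magnon-Ashtekar,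
  Phys. Rev. Lett. 43 (1979) 181).

These properties do **not** follow from the fields of `BondiFoliation` alone: for arbitrary
(non-asymptotically-round) sections of a shear-free Schwarzschild cone the limit of the Hawking
masses is `M · √(⨍R²) · ⨍(1/R) ≥ M`, which depends on the sections and can exceed `E_ADM = M`.
The intrinsic characterisation of the canonical foliation needs the notion `bondi_mass_news`
(tier L, out of scope), whence a hypothesis structure rather than sorried theorems. [cite: SchoenYau1982, Horowitz–Perry 1982    Ludvigsen–Vickers] -/
structure IsCanonical (e : AFEnd X) : Prop where
  /-- The Hawking masses converge along every outgoing cone `C⁺_u` (CK 1993, 17.0.3). -/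
  hasBondiMass (u : ℝ) : ∃ m, 𝓕.HasBondiMass u m
  /-- Bondi mass loss: `u ↦ M_B(u)` is non-increasing (BvdBM 1962, §5; CK 1993, 17.0.8). -/
  bondiMass_antitone : Antitone 𝓕.bondiMass
  /-- Positivity of the Bondi mass (Schoen–Yau 1982). -/
  bondiMass_nonneg (u : ℝ) : 0 ≤ 𝓕.bondiMass u
  /-- The Bondi mass is bounded by the ADM energy of the end `e` (CK 1993, 17.0.8–17.0.9). -/
  bondiMass_le_admEnergy (u : ℝ) : 𝓕.bondiMass u ≤ AFEnd.admEnergy e D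

variable {𝓕} {e : AFEnd X}

/-- For a canonical Bondi foliation, `HasBondiMass u (bondiMass u)` at every retarded time
(Christodoulou–Klainerman 1993, Ch. 17, conclusion 17.0.3). [cite: ChristodoulouKlainerman1993, Ch. 17  conclusion 17.0.3] -/
lemma IsCanonical.hasBondiMass_bondiMass (hc : 𝓕.IsCanonical e) (u : ℝ) :
    𝓕.HasBondiMass u (𝓕.bondiMass u) :=
  BondiFoliation.hasBondiMass_bondiMass hc.hasBondiMass u

/-- **Bondi mass loss** (Bondi–van der Burg–Metzner, Proc. Roy. Soc. A 269 (1962), §5;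
Christodoulou–Klainerman 1993, Ch. 17, conclusion 17.0.8: `∂_u M_B = -(32π)⁻¹ ∫ |Ξ|² ≤ 0`).
For a canonical Bondi foliation the Bondi mass is a non-increasing function of retarded time
(a field of the hypothesis structure `IsCanonical`, restated). [cite: ChristodoulouKlainerman1993, Ch. 17  conclusion 17.0.8:  ∂_u M_B = -(] -/
theorem bondiMass_antitone (hc : 𝓕.IsCanonical e) : Antitone 𝓕.bondiMass :=
  hc.2

/-- **Positivity of the Bondi mass** (Schoen–Yau, Phys. Rev. Lett. 48 (1982) 369; Horowitz–Perry
1982; Ludvigsen–Vickers 1982). For a canonical Bondi foliation the Bondi mass is nonnegative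
(a field of `IsCanonical`, restated). [cite: LudvigsenVickers1982] -/
theorem bondiMass_nonneg (hc : 𝓕.IsCanonical e) (u : ℝ) : 0 ≤ 𝓕.bondiMass u :=
  hc.3 u

/-- **The Bondi mass is bounded by the ADM energy** (Christodoulou–Klainerman 1993, Ch. 17,
conclusions 17.0.8–17.0.9; Ashtekar–Magnon-Ashtekar, Phys. Rev. Lett. 43 (1979) 181):
`M_B(u) ≤ E_ADM` for every retarded time `u` — the difference is the energy radiated through
`𝓘⁺` before `u` (a field of `IsCanonical`, restated). [cite: ChristodoulouKlainerman1993, Ch. 17  conclusions 17.0.8–17.0.9] -/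
theorem bondiMass_le_admEnergy (hc : 𝓕.IsCanonical e) (u : ℝ) :
    𝓕.bondiMass u ≤ AFEnd.admEnergy e D :=
  hc.4 u

/-- A non-increasing function bounded below converges at `+∞`: for a canonical Bondi foliation
the final Bondi mass exists and equals `⨅ u, M_B(u)`. Christodoulou–Klainerman 1993, Ch. 17,
conclusion 17.0.9. [cite: ChristodoulouKlainerman1993, Ch. 17  conclusion 17.0.9] -/
theorem IsCanonical.hasFinalBondiMass (hc : 𝓕.IsCanonical e) :
    𝓕.HasFinalBondiMass (⨅ u, 𝓕.bondiMass u) :=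
  tendsto_atTop_ciInf hc.bondiMass_antitone ⟨0, by rintro _ ⟨u, rfl⟩; exact hc.bondiMass_nonneg u⟩

/-- **Final Bondi mass vs ADM mass** (mass bookkeeping in the final-state picture;
Christodoulou–Klainerman 1993, Ch. 17, conclusion 17.0.9; Bondi–van der Burg–Metzner 1962). For a
canonical Bondi foliation the final Bondi mass is at most the ADM energy: `M_B(+∞) ≤ E_ADM`
(with `E_ADM - M_B(+∞) = (32π)⁻¹ ∫∫ |Ξ|² du` the total radiated energy, out of scope). [cite: ChristodoulouKlainerman1993, Ch. 17  conclusion 17.0.9] -/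
theorem finalBondiMass_le_admEnergy (hc : 𝓕.IsCanonical e) :
    𝓕.finalBondiMass ≤ AFEnd.admEnergy e D := by
  have hm := hc.hasFinalBondiMass
  rw [hm.finalBondiMass_eq]
  exact le_of_tendsto' hm fun u ↦ bondiMass_le_admEnergy hc u

/-- For a canonical Bondi foliation the final Bondi mass is nonnegative (Schoen–Yau 1982;
Christodoulou–Klainerman 1993, Ch. 17, conclusion 17.0.9). [cite: SchoenYau1982] -/
theorem finalBondiMass_nonneg (hc : 𝓕.IsCanonical e) : 0 ≤ 𝓕.finalBondiMass := by
  have hm := hc.hasFinalBondiMass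
  rw [hm.finalBondiMass_eq]
  exact ge_of_tendsto' hm fun u ↦ bondiMass_nonneg hc u

end BondiFoliation

end Literature.Geometry.Lorentzian

end
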